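import Mathlib
import Summits.MatrixMultiplication.Statement
import Summits.MatrixMultiplication.MatrixMultiplication.Theorems.GraphEquationsTowerSupply
import Summits.MatrixMultiplication.MatrixMultiplication.Theorems.GraphEquationsJetTruncation
import Literature.Computability.AlgebraicComplexity.FlatteningBound

/-!
# Graph equations — the exponent dial at the level of systems (M25e)

Consequences of the unconditional tower supply (`towerSupply`) for CORRECT EQUATION SYSTEMS:

* `tensorRank_le_towerMultiplier_of_correct` — a correct system `E` whose test ideal contains the
  `m`-th powers of the graph generators is a matrix-multiplication algorithm up to the constant
  `2·3^{m-1}`: `R(⟨n,n,n⟩) ≤ 2·3^{m-1}·cost(E)`;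
* `exists_exponent_tensorRank_le` — EVERY correct system has such an `m` (Nullstellensatz), so every
  correct system is an algorithm up to a constant depending only on its multiplicity;
* `EqAdmissibleExp β m` (cost-`O(n^β)` correct systems of membership exponent `≤ m`) gives
  `ω ≤ β` (`omega_le_of_eqAdmissibleExp`, generalising `omega_le_of_eqAdmissibleInit/Jet` to
  arbitrary fat-point structure) and reduced systems above `β`;
* `matrixMultiplication_iff_exists_boundedExponent` — `ω = 2 ↔ ∃ m ≥ 1, ∀ β > 2, EqAdmissibleExp β m`:
  the summit is EXACTLY the existence of quadratic-cost correct systems of BOUNDED multiplicity;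
  what `GraphEquationsQuadratic` leaves open is only the growth of the multiplicity `m(n)`.
-/

set_option linter.dupNamespace false

noncomputable section

open scoped BigOperators

namespace Summit.MatrixMultiplication.MatrixMultiplication.Theorems.GraphEquations

open MvPolynomial
open Literature.Computability.AlgebraicComplexity

/-- **A correct system of membership exponent `m` is an algorithm up to `2·3^{m-1}`.** -/
theorem tensorRank_le_towerMultiplier_of_correct {n : ℕ} (hn : 1 ≤ n) (E : EqSystem n)
    (hE : E.Correct) {m : ℕ} (hm : 1 ≤ m)
    (hmem : ∀ q : Fin n × Fin n, generator n q ^ m ∈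
      Ideal.span (Set.range fun o : Fin E.tests.length => E.testPoly (E.tests.get o))) :
    tensorRank (matMulTensor ℂ n n n) ≤ 2 * 3 ^ (m - 1) * E.cost := by
  obtain ⟨gs, hns, hlen, hfs⟩ := exists_isNonscalarSeq_tests E hE.1
  exact tensorRank_le_towerMultiplier hm hn _
    (fun o => hE.testPoly_mem_graphIdeal' (List.get_mem E.tests o)) ⟨gs, hns, hlen, hfs⟩ hmem

/-- **Every correct system is an algorithm up to a constant depending only on its multiplicity.** -/
theorem exists_exponent_tensorRank_le {n : ℕ} (hn : 1 ≤ n) (E : EqSystem n) (hE : E.Correct) :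
    ∃ m : ℕ, 1 ≤ m ∧
      (∀ q : Fin n × Fin n, generator n q ^ m ∈
        Ideal.span (Set.range fun o : Fin E.tests.length => E.testPoly (E.tests.get o))) ∧
      tensorRank (matMulTensor ℂ n n n) ≤ 2 * 3 ^ (m - 1) * E.cost := by
  obtain ⟨m, hm, hmem⟩ := hE.exists_uniform_generator_pow_mem
  exact ⟨m, hm, hmem, tensorRank_le_towerMultiplier_of_correct hn E hE hm hmem⟩

/-- `EqAdmissibleExp β m`: cost-`O(n^β)` correct systems whose test ideal contains the `m`-th powers
of the graph generators (membership exponent `≤ m`). -/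
def EqAdmissibleExp (β : ℝ) (m : ℕ) : Prop :=
  ∃ c : ℝ, ∀ n : ℕ, 1 ≤ n → ∃ E : EqSystem n, E.Correct ∧
    (∀ q : Fin n × Fin n, generator n q ^ m ∈
      Ideal.span (Set.range fun o : Fin E.tests.length => E.testPoly (E.tests.get o))) ∧
    (E.cost : ℝ) ≤ c * (n : ℝ) ^ β

/-- Monotonicity in the exponent. -/
theorem EqAdmissibleExp.mono {β : ℝ} {m m' : ℕ} (h : EqAdmissibleExp β m) (hmm' : m ≤ m') :
    EqAdmissibleExp β m' := by
  obtain ⟨c, hc⟩ := h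
  refine ⟨c, fun n hn => ?_⟩
  obtain ⟨E, hE, hmem, hcost⟩ := hc n hn
  refine ⟨E, hE, fun q => ?_, hcost⟩
  rw [← Nat.add_sub_cancel' hmm', pow_add]
  exact Ideal.mul_mem_right _ _ (hmem q)
  
/-- `EqAdmissibleExp β m → EqAdmissible β`. -/
theorem EqAdmissibleExp.eqAdmissible {β : ℝ} {m : ℕ} (h : EqAdmissibleExp β m) : EqAdmissible β := by
  obtain ⟨c, hc⟩ := h
  refine ⟨c, fun n hn => ?_⟩
  obtain ⟨E, hE, -, hcost⟩ := hc n hn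
  exact ⟨E, hE, hcost⟩

/-- **Cheap bounded-multiplicity systems force fast multiplication**: `EqAdmissibleExp β m → ω ≤ β`. -/
theorem omega_le_of_eqAdmissibleExp {β : ℝ} {m : ℕ} (hm : 1 ≤ m) (h : EqAdmissibleExp β m) :
    omega ℂ ≤ β := by
  obtain ⟨c, hc⟩ := h
  have hmem : β ∈ admissibleExponents ℂ := by
    change (fun n : ℕ => (tensorRank (matMulTensor ℂ n n n) : ℝ)) =O[Filter.atTop]
      fun n : ℕ => (n : ℝ) ^ β
    refine Asymptotics.IsBigO.of_bound (2 * 3 ^ (m - 1) * |c|) ?_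
    filter_upwards [Filter.eventually_ge_atTop 1] with n hn
    obtain ⟨E, hE, hgen, hcost⟩ := hc n hn
    have h1 := tensorRank_le_towerMultiplier_of_correct hn E hE hm hgen
    rw [Real.norm_of_nonneg (Nat.cast_nonneg _),
      Real.norm_of_nonneg (Real.rpow_nonneg (Nat.cast_nonneg _) _)]
    have h3 : (tensorRank (matMulTensor ℂ n n n) : ℝ) ≤ 2 * 3 ^ (m - 1) * (E.cost : ℝ) := by
      exact_mod_cast h1
    have h4 : c * (n : ℝ) ^ β ≤ |c| * (n : ℝ) ^ β := by
      gcongr; exact le_abs_self c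
    have h5 : (0 : ℝ) ≤ 2 * 3 ^ (m - 1) := by positivity
    calc (tensorRank (matMulTensor ℂ n n n) : ℝ) ≤ 2 * 3 ^ (m - 1) * (E.cost : ℝ) := h3
      _ ≤ 2 * 3 ^ (m - 1) * (|c| * (n : ℝ) ^ β) :=
        mul_le_mul_of_nonneg_left (hcost.trans h4) h5
      _ = 2 * 3 ^ (m - 1) * |c| * (n : ℝ) ^ β := by ring
  exact csInf_le (admissibleExponents_bddBelow ℂ) hmem

/-- … hence reduced systems strictly above `β` (the currency of `MultiplicityReduction`). -/
theorem eqAdmissibleRed_of_eqAdmissibleExp {β : ℝ} {m : ℕ} (hm : 1 ≤ m) (h : EqAdmissibleExp β m)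
    {β' : ℝ} (hββ' : β < β') : EqAdmissibleRed β' :=
  eqAdmissibleIdealIso_one_iff_red.mp
    (eqAdmissibleIdealIso_one_of_omega_lt ((omega_le_of_eqAdmissibleExp hm h).trans_lt hββ'))

/-- Above `ω` there are cost-`O(n^β)` systems of membership exponent `1`. -/
theorem eqAdmissibleExp_one_of_omega_lt {β : ℝ} (hβ : omega ℂ < β) : EqAdmissibleExp β 1 :=
  exists_correct_generator_mem_of_omega_lt hβ

/-- **THE EXPONENT DIAL**: `ω = 2 ↔` quadratic-cost correct systems of BOUNDED multiplicity exist. -/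
theorem matrixMultiplication_iff_exists_boundedExponent :
    _root_.MatrixMultiplication ↔ ∃ m : ℕ, 1 ≤ m ∧ ∀ β : ℝ, 2 < β → EqAdmissibleExp β m := by
  constructor
  · intro h
    refine ⟨1, le_rfl, fun β hβ => eqAdmissibleExp_one_of_omega_lt ?_⟩
    have h' : omega ℂ = 2 := h
    rw [h']; exact hβ
  · rintro ⟨m, hm, h⟩
    show omega ℂ = 2
    refine le_antisymm ?_ (omega_two_le ℂ)
    refine le_of_forall_gt_imp_ge_of_dense fun β hβ => ?_
    exact omega_le_of_eqAdmissibleExp hm (h β hβ)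

/-- In particular `GraphEquationsQuadratic` with a UNIFORM membership exponent is the summit. -/
theorem matrixMultiplication_of_boundedExponent {m : ℕ} (hm : 1 ≤ m)
    (h : ∀ β : ℝ, 2 < β → EqAdmissibleExp β m) : _root_.MatrixMultiplication :=
  matrixMultiplication_iff_exists_boundedExponent.mpr ⟨m, hm, h⟩

end Summit.MatrixMultiplication.MatrixMultiplication.Theorems.GraphEquations

end
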